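import Literature.AnabelianGeometry.AbsoluteAnabelian.FreeProSigmaCyclicSubgroups
import HarnessLib

/-!
# Closed subgroups of `Ẑ^Σ` are `Ẑ^{Σ'}` (abstract free pro-`Σ`-cyclic profinite groups)

Sequel to `FreeProSigmaCyclicSubgroups` (the model `∏_i ℤ_{p_i}`: closed subgroups are products of
closed ideals, `exists_subset_range_isFreeProSigmaCyclic_of_isClosed_padicPi`).  Here the statement is
transported to an ARBITRARY compact Hausdorff totally disconnected group satisfying abc-iut-L4-t6's
intrinsic predicate `AbsTopII.IsFreeProSigmaCyclic Σ` ([AbsTopII] Prop. 1.3 (i) p. 11 "as abstract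
profinite groups, `≅ Ẑ^Σ`") along the structure theorem
`IsFreeProSigmaCyclic.exists_continuousMulEquiv_padicSigmaProd` (FreeProcyclicStructure):

* `AbsTopII.IsFreeProSigmaCyclic.exists_subset_of_isClosed` — every closed subgroup of a free
  pro-`Σ`-cyclic profinite group is free pro-`Σ'`-cyclic for a set of primes `Σ' ⊆ Σ`;
* `AbsTopII.IsFreeProSigmaCyclic.eq_one_of_forall_not_prime` — `Σ'` without primes forces triviality;
* `AbsTopII.IsFreeProSigmaCyclic.eq_bot_or_singleton_of_isClosed`,
  `AbsTopII.IsFreeProSigmaCyclic.subgroup_singleton_of_isClosed_of_infinite` — `Σ = {l}`: a closed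
  subgroup of a `ℤ_l`-group is `⊥` or again `≅ ℤ_l`; an infinite closed one is `≅ ℤ_l` (the abelian
  special case of the "`I ≅ ℤ_l`" encoding used by [AbsTopI] Lemma 4.5 (iv) / [CombGC] Thm 1.6 (i)).

Proof-only (no definitions); classical profinite group theory [cite: RibesZalesskii2010, Thm 2.7.1].
HONEST FRAMING: nothing here bears on [IUTchIII] Cor. 3.12; typed ≠ proved elsewhere; no side is taken
on any disputed claim.
-/

noncomputable section

open Topology
open scoped Pointwise

namespace Literature.AnabelianGeometry.AbsoluteAnabelian

open Literature.AnabelianGeometry.Anabelioids (IsSigmaInteger)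

universe u

/-! ### Closed subgroups of an abstract free pro-`Σ`-cyclic profinite group -/

section ClosedSubgroups

variable {G : Type u} [Group G] [TopologicalSpace G] [IsTopologicalGroup G]

/-- **Closed subgroups of `Ẑ^Σ` are `≅ Ẑ^{Σ'}` for some set of primes `Σ' ⊆ Σ`.**  In a compact Hausdorff
totally disconnected free pro-`Σ`-cyclic group `G` (`≅ ∏_{p ∈ Σ} ℤ_p` by abc-iut-L4-t6's structure
theorem), every CLOSED subgroup `H` is free pro-`Σ'`-cyclic for a set `Σ'` of primes contained in `Σ`
(transport the image of `H` in the model and apply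
`exists_subset_range_isFreeProSigmaCyclic_of_isClosed_padicPi`).
[cite: MochizukiAbsTopII2013, Prop 1.3 (i) p.11] -/
theorem AbsTopII.IsFreeProSigmaCyclic.exists_subset_of_isClosed {S : Set ℕ} [CompactSpace G]
    [T2Space G] [TotallyDisconnectedSpace G] (h : AbsTopII.IsFreeProSigmaCyclic S G)
    (H : Subgroup G) (hH : IsClosed (H : Set G)) :
    ∃ S' ⊆ S, (∀ q ∈ S', q.Prime) ∧ AbsTopII.IsFreeProSigmaCyclic S' H := by
  obtain ⟨e, -, -, -⟩ := h.exists_continuousMulEquiv_padicSigmaProd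
  let P : {p : Nat.Primes // (p : ℕ) ∈ S} → ℕ := fun p => (p.1 : ℕ)
  haveI hPr : ∀ p : {p : Nat.Primes // (p : ℕ) ∈ S}, Fact (Nat.Prime (P p)) := fun p => ⟨p.1.2⟩
  have hinj : Function.Injective P := fun a b hab =>
    Subtype.ext (Nat.Primes.coe_nat_injective hab)
  -- the image of `H` in the model is a closed subgroup
  let K : Subgroup (Multiplicative (∀ p : {p : Nat.Primes // (p : ℕ) ∈ S}, ℤ_[P p])) :=
    H.map (e.toMulEquiv : G →* _)
  haveI : T2Space (Multiplicative (∀ p : {p : Nat.Primes // (p : ℕ) ∈ S}, ℤ_[P p])) :=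
    inferInstanceAs (T2Space (∀ p : {p : Nat.Primes // (p : ℕ) ∈ S}, ℤ_[P p]))
  have hK : IsClosed (K : Set (Multiplicative (∀ p : {p : Nat.Primes // (p : ℕ) ∈ S}, ℤ_[P p]))) := by
    have h1 : (K : Set _) = e '' (H : Set G) := Subgroup.coe_map _ _
    rw [h1]
    exact (hH.isCompact.image e.continuous).isClosed
  obtain ⟨S', hS', hK'⟩ := exists_subset_range_isFreeProSigmaCyclic_of_isClosed_padicPi P hinj K hK
  -- `H ≃ₜ* K` by restricting `e`
  have hto : ∀ x : H, e (x : G) ∈ K := fun x => Subgroup.mem_map_of_mem _ x.2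
  have hinv : ∀ y : K, e.symm (y : Multiplicative (∀ p, ℤ_[P p])) ∈ H := by
    intro y
    obtain ⟨x, hx, hxy⟩ := Subgroup.mem_map.mp y.2
    have h1 : e.symm (y : Multiplicative (∀ p, ℤ_[P p])) = x := by
      rw [ContinuousMulEquiv.symm_apply_eq]
      exact hxy.symm
    rw [h1]
    exact hx
  let EH : H ≃ₜ* K :=
    { toFun := fun x => ⟨e (x : G), hto x⟩
      invFun := fun y => ⟨e.symm (y : Multiplicative (∀ p, ℤ_[P p])), hinv y⟩
      left_inv := fun x => Subtype.ext (e.symm_apply_apply (x : G))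
      right_inv := fun y => Subtype.ext (e.apply_symm_apply (y : Multiplicative (∀ p, ℤ_[P p])))
      map_mul' := fun x y => Subtype.ext (map_mul e (x : G) (y : G))
      continuous_toFun := Continuous.subtype_mk (e.continuous.comp continuous_subtype_val) _
      continuous_invFun := Continuous.subtype_mk (e.symm.continuous.comp continuous_subtype_val) _ }
  refine ⟨S', fun q hq => ?_, fun q hq => ?_, hK'.of_continuousMulEquiv EH.symm⟩
  · obtain ⟨p, rfl⟩ := hS' hq
    exact p.2
  · obtain ⟨p, rfl⟩ := hS' hq
    exact p.1.2

omit [IsTopologicalGroup G] in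
/-- A free pro-`Σ'`-cyclic compact Hausdorff totally disconnected group with NO prime in `Σ'` is
trivial: every open subgroup has index a `Σ'`-integer, i.e. `1`, and the open subgroups of a
profinite group separate points. [cite: MochizukiAbsTopII2013, Prop 1.3 (i) p.11] -/
theorem AbsTopII.IsFreeProSigmaCyclic.eq_one_of_forall_not_prime {S : Set ℕ} [IsTopologicalGroup G]
    [CompactSpace G] [T2Space G] [TotallyDisconnectedSpace G] (h : AbsTopII.IsFreeProSigmaCyclic S G)
    (hS : ∀ q ∈ S, ¬ q.Prime) (x : G) : x = 1 := by
  refine eq_one_of_forall_isOpen_mem fun U hU => ?_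
  have hidx : IsSigmaInteger S U.index := (h.isOpen_index_iff U.index).mp ⟨U, hU, rfl⟩
  have h1 : U.index = 1 := by
    by_contra hne
    have hmin : (U.index).minFac.Prime := Nat.minFac_prime hne
    exact hS _ (hidx.2 _ hmin (Nat.minFac_dvd _)) hmin
  rw [Subgroup.index_eq_one] at h1
  rw [h1]
  exact Subgroup.mem_top x

/-- **`Σ = {l}`: a closed subgroup of a `ℤ_l`-group is trivial or again `≅ ℤ_l`.**  In a compact
Hausdorff totally disconnected free pro-`{l}`-cyclic group, every closed subgroup `H` is either `⊥` or
free pro-`{l}`-cyclic (the abelian special case of the characterisation of the `≅ ℤ_l` closed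
subgroups of a pro-`l` group, cf. [CombGC] Thm 1.6 (i) / [AbsTopI] Lemma 4.5 (iv) "`I ≅ ℤ_l`").
[cite: MochizukiAbsTopI2012, Lemma 4.5 (iv) p.54] -/
theorem AbsTopII.IsFreeProSigmaCyclic.eq_bot_or_singleton_of_isClosed {l : ℕ} [CompactSpace G]
    [T2Space G] [TotallyDisconnectedSpace G] (h : AbsTopII.IsFreeProSigmaCyclic {l} G)
    (H : Subgroup G) (hH : IsClosed (H : Set G)) :
    H = ⊥ ∨ AbsTopII.IsFreeProSigmaCyclic {l} H := by
  obtain ⟨S', hS', -, hH'⟩ := h.exists_subset_of_isClosed H hH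
  by_cases hl : l ∈ S'
  · right
    have h1 : S' = {l} := Set.Subset.antisymm hS' (Set.singleton_subset_iff.mpr hl)
    rwa [h1] at hH'
  · left
    have hS'e : ∀ q ∈ S', ¬ q.Prime := by
      intro q hq _
      have h1 : q = l := Set.mem_singleton_iff.mp (hS' hq)
      exact hl (h1 ▸ hq)
    haveI : CompactSpace H := isCompact_iff_compactSpace.mp hH.isCompact
    rw [Subgroup.eq_bot_iff_forall]
    intro x hx
    exact congrArg Subtype.val (hH'.eq_one_of_forall_not_prime hS'e ⟨x, hx⟩)

/-- The same, in the shape of the "`≅ ℤ_l` encoding" hypotheses of the cell ([AbsTopI] Lemma 4.5 (iv)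
rows): an INFINITE closed subgroup of a compact Hausdorff totally disconnected free pro-`{l}`-cyclic
group is free pro-`{l}`-cyclic. [cite: MochizukiAbsTopI2012, Lemma 4.5 (iv) p.54] -/
theorem AbsTopII.IsFreeProSigmaCyclic.subgroup_singleton_of_isClosed_of_infinite {l : ℕ}
    [CompactSpace G] [T2Space G] [TotallyDisconnectedSpace G]
    (h : AbsTopII.IsFreeProSigmaCyclic {l} G) (H : Subgroup G) (hH : IsClosed (H : Set G))
    (hinf : (H : Set G).Infinite) : AbsTopII.IsFreeProSigmaCyclic {l} H := by
  rcases h.eq_bot_or_singleton_of_isClosed H hH with h1 | h1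
  · exfalso
    apply hinf
    rw [h1, Subgroup.coe_bot]
    exact Set.finite_singleton 1
  · exact h1

end ClosedSubgroups

end Literature.AnabelianGeometry.AbsoluteAnabelian

end
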